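import Summits.QuantumFields.YangMills.Theorems.SwapVirialDeficitSectorLaplaceWindow
import HarnessLib

/-!
# (S)-road under E1, stub S6c′: THE WINDOW ARITHMETIC WITHOUT GNOMONIC CUT, in the letters of ✓`SectorLaplaceDefs` §4 (`bulkHubIntegral`, `mbHubBulk`)
# (free-hands support of ⟨stmt-QuantumFields-24197⟩ `SwapVirialDeficit.SwapGluedStiffness` ∕ ⟨24194⟩ `SwapMeanActionGap`; cell ym-idea-1, assembler fcl-p3 g47)

E1 (w2 g59 2026-08-31 18:24Z∕18:35Z): with the rescaled fibre the bulk fibred law `bulk_fibred_plane` holds on the whole base `ℝ²` with degradation `(1∕ψ₀)^k` only,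
so the sector-000 assembly has ONE cut `ψ₀ = b^{−σ}` in the hub and no gnomonic cut `V₀`.  This is the `V₀`-free twin of ✓`window_arith` (✓`SectorLaplaceWindow`,
whose scalar lemmas `exp_absorb`, `sigma_facts`, `monomial_dom`, `bracket_le`, `threshold_facts`, `bulk_two_sided` are reused):

* §1 `inv_cut_pow` (`(1∕ψ₀)^k = b^{σk}`), `sTwo_threshold_plane`, `offTube_exponent_plane_le`;
* §2 ★★ `window_arith_plane` — inputs S2i′ (`bulkHubIntegral` vs `mbHubBulk`), S4′ (`0 ≤ 𝔐₀ − mbHubBulk ψ₀ ≤ K L^k ψ₀^κ 𝔐₀`, `0 < 𝔐₀`), S4b, S5′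
  (`good − bulkHub ≤ K L^k(ψ₀^κ + b^{−κ′})·Main`), S6a′ (✓`split_plane`, unconditional) ⟹ the `h₀` clause of ✓`swapGluedStiffness_of_bulk_rest_rate`
  (exponent `9L⁴ − 1`, main constant `mbConst L`, rates `θ₂ = min(1∕4, σκ)`, `θ₃ = min(1∕4, σκ₅, κ′)`).

HONEST LABEL: arithmetic glue with the analytic inputs as HYPOTHESES (S2i′ = w2's `bulk_fibred_plane` + S3; S4′∕S5′ conditional on one-loop determinant uniformity per
LEAD 18:02Z; S4b = ✓`mbConst_floor_of_S3`; S6a′ = ✓`split_plane`); ⟨24197⟩ ∕ ⟨24194⟩ OPEN; ⟨24196⟩ proved elsewhere; item of record ⟨24085⟩ SubOctaveBounded aside ∕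
untouched; the Yang–Mills mass gap is NOT proved; no summit is proved by a line.  THEOREMS ONLY (0 `def`, 0 `sorry`, no instance), standard axioms.  Seat
ym-line-fcl-p3 g47 (cell ym-idea-1, free hands), `--supports stmt-QuantumFields-24197`.  References: [cite: Luscher1983, §2]; [folklore].
-/

set_option autoImplicit false

noncomputable section

namespace Summit.QuantumFields.YangMills.Theorems.SwapVirialDeficit.SectorLaplace

/-! ## §1 Scalar lemmas for the single cut -/

/-- The inverse cut: `(1∕ψ₀)^k = b^{σk}` for `ψ₀ = b^{−σ}`. [folklore] -/
theorem inv_cut_pow {b σ ψ₀ : ℝ} (hb0 : 0 < b) (hψ : ψ₀ = b ^ (-σ)) (k : ℕ) : (1 / ψ₀) ^ k = b ^ (σ * k) := by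
  have e : 1 / ψ₀ = b ^ σ := by rw [hψ, Real.rpow_neg hb0.le, one_div, inv_inv]
  rw [e, ← Real.rpow_natCast, ← Real.rpow_mul hb0.le]

/-- S2′'s threshold on the window: `(K₂ L^{k₂} (1∕ψ₀)^{k₂})² ≤ b` from `K₂² L^{2k₂} ≤ b^{3∕4}` and `2σk₂ ≤ 1∕4`. [folklore] -/
theorem sTwo_threshold_plane {b σ K₂ L ψ₀ : ℝ} {k₂ : ℕ} (hb1 : 1 ≤ b) (hψ : ψ₀ = b ^ (-σ))
    (hσ2 : 2 * σ * k₂ ≤ 1 / 4) (hpiece : K₂ ^ 2 * L ^ (2 * k₂) ≤ b ^ (3 / 4 : ℝ)) :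
    (K₂ * L ^ k₂ * (1 / ψ₀) ^ k₂) ^ 2 ≤ b := by
  have hb0 : 0 < b := by linarith
  rw [inv_cut_pow hb0 hψ k₂]
  have e1 : (K₂ * L ^ k₂ * b ^ (σ * k₂)) ^ 2 = K₂ ^ 2 * L ^ (2 * k₂) * b ^ (2 * σ * k₂) := by
    rw [mul_pow, mul_pow, ← pow_mul, ← Real.rpow_natCast (b ^ (σ * k₂)) 2, ← Real.rpow_mul hb0.le]
    push_cast; ring_nf
  rw [e1]
  have h1 : b ^ (2 * σ * ↑k₂) ≤ b ^ (1 / 4 : ℝ) := Real.rpow_le_rpow_of_exponent_le hb1 hσ2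
  calc K₂ ^ 2 * L ^ (2 * k₂) * b ^ (2 * σ * ↑k₂) ≤ b ^ (3 / 4 : ℝ) * b ^ (1 / 4 : ℝ) :=
        mul_le_mul hpiece h1 (Real.rpow_nonneg hb0.le _) (Real.rpow_nonneg hb0.le _)
    _ = b := by rw [← Real.rpow_add hb0]; norm_num

/-- The off-tube exponent of S2i′ on the window: `b^{1∕4}(4(9L⁴+1) + K₅L^{k₅}) ≤ b·(ψ₀∕(K₂L^{k₂}))^{k₂}` from `σk₂ ≤ 1∕4` and
`K₂^{k₂}(40+K₅)·L^{k₂²+4+k₅} ≤ b^{1∕2}`. [folklore] -/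
theorem offTube_exponent_plane_le {b σ K₂ K₅ L ψ₀ : ℝ} {k₂ k₅ : ℕ} (hb1 : 1 ≤ b) (hL1 : 1 ≤ L) (hK₂ : 0 < K₂) (hK₅ : 0 < K₅)
    (hψ : ψ₀ = b ^ (-σ)) (hσk : σ * k₂ ≤ 1 / 4)
    (hpiece : K₂ ^ k₂ * (40 + K₅) * L ^ (k₂ * k₂ + 4 + k₅) ≤ b ^ (1 / 2 : ℝ)) :
    b ^ (1 / 4 : ℝ) * (4 * (9 * L ^ 4 + 1) + K₅ * L ^ k₅) ≤ b * (ψ₀ / (K₂ * L ^ k₂)) ^ k₂ := by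
  have hb0 : 0 < b := by linarith
  have hL0 : 0 < L := by linarith
  have hbr := bracket_le (k₅ := k₅) hL1 hK₅.le
  have hD0 : 0 < (K₂ * L ^ k₂) ^ k₂ := by positivity
  have e3 : b * ψ₀ ^ k₂ = b ^ (1 - σ * k₂) := by
    rw [hψ, ← Real.rpow_natCast _ k₂, ← Real.rpow_mul hb0.le]
    nth_rewrite 1 [← Real.rpow_one b]
    rw [← Real.rpow_add hb0]
    congr 1; ring
  have eX : b * (ψ₀ / (K₂ * L ^ k₂)) ^ k₂ = b ^ (1 - σ * k₂) / (K₂ * L ^ k₂) ^ k₂ := by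
    rw [div_pow, ← mul_div_assoc, e3]
  rw [eX, le_div_iff₀ hD0]
  have h34 : b ^ (3 / 4 : ℝ) ≤ b ^ (1 - σ * k₂) := Real.rpow_le_rpow_of_exponent_le hb1 (by linarith)
  have hDM : (4 * (9 * L ^ 4 + 1) + K₅ * L ^ k₅) * (K₂ * L ^ k₂) ^ k₂ ≤ b ^ (1 / 2 : ℝ) := by
    have e2 : (K₂ * L ^ k₂) ^ k₂ = K₂ ^ k₂ * L ^ (k₂ * k₂) := by rw [mul_pow, ← pow_mul]
    rw [e2]
    calc (4 * (9 * L ^ 4 + 1) + K₅ * L ^ k₅) * (K₂ ^ k₂ * L ^ (k₂ * k₂))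
        ≤ (40 + K₅) * L ^ (4 + k₅) * (K₂ ^ k₂ * L ^ (k₂ * k₂)) := mul_le_mul_of_nonneg_right hbr (by positivity)
      _ = K₂ ^ k₂ * (40 + K₅) * L ^ (k₂ * k₂ + 4 + k₅) := by ring
      _ ≤ b ^ (1 / 2 : ℝ) := hpiece
  calc b ^ (1 / 4 : ℝ) * (4 * (9 * L ^ 4 + 1) + K₅ * L ^ k₅) * (K₂ * L ^ k₂) ^ k₂
      ≤ b ^ (1 / 4 : ℝ) * b ^ (1 / 2 : ℝ) := by rw [mul_assoc]; exact mul_le_mul_of_nonneg_left hDM (Real.rpow_nonneg hb0.le _)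
    _ = b ^ (3 / 4 : ℝ) := by rw [← Real.rpow_add hb0]; norm_num
    _ ≤ b ^ (1 - σ * k₂) := h34

/-! ## §2 The window arithmetic without gnomonic cut -/

set_option maxHeartbeats 400000 in
/-- ★★ **S6c′ — THE WINDOW ARITHMETIC WITHOUT GNOMONIC CUT (E1)** (fcl-p3 g47): with `σ = 1∕(4(k+1)²)` (`k` = S2′'s degradation exponent), `ψ₀ = b^{−σ}`,
the inputs S2i′, S4′, S4b, S5′, S6a′ give the `h₀` clause of ✓`swapGluedStiffness_of_bulk_rest_rate` for sector 000 — exponent `9L⁴ − 1`, main constant `mbConst L`, rates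
`θ₂ = min(1∕4, σκ)`, `θ₃ = min(1∕4, min(σκ₅, κ′))` — above a polynomial threshold; the two absolute exponentials (S2′'s off-tube term, S6a′'s bad signs) are
absorbed by S4b (✓`exp_absorb`). [cite: Luscher1983, §2] -/
theorem window_arith_plane
    (hS2i : ∃ K : ℝ, 0 < K ∧ ∃ k : ℕ, ∀ (L : ℕ) [NeZero L] (ψ₀ b : ℝ), 0 < ψ₀ → ψ₀ ≤ 1 →
      (K * (L : ℝ) ^ k * (1 / ψ₀) ^ k) ^ 2 ≤ b →
        0 ≤ mbHubBulk L ψ₀ ∧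
        |bulkHubIntegral L b ψ₀ - (2 * Real.pi / b) ^ alpha L * mbHubBulk L ψ₀| ≤
          K * (L : ℝ) ^ k * (1 / ψ₀) ^ k * b ^ (-(1 / 2 : ℝ)) * ((2 * Real.pi / b) ^ alpha L * mbHubBulk L ψ₀) +
            Real.exp (-(b * (ψ₀ / (K * (L : ℝ) ^ k)) ^ k)))
    (hS4 : ∃ K : ℝ, 0 < K ∧ ∃ κ : ℝ, 0 < κ ∧ ∃ k : ℕ, ∀ (L : ℕ) [NeZero L],
      0 < mbConst L ∧ ∀ ψ₀ : ℝ, 0 < ψ₀ → ψ₀ ≤ 1 →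
        0 ≤ mbConst L - mbHubBulk L ψ₀ ∧ mbConst L - mbHubBulk L ψ₀ ≤ K * (L : ℝ) ^ k * ψ₀ ^ κ * mbConst L)
    (hS4b : ∃ K : ℝ, 0 < K ∧ ∃ k : ℕ, ∀ (L : ℕ) [NeZero L], Real.exp (-(K * (L : ℝ) ^ k)) ≤ mbConst L)
    (hS5 : ∃ K : ℝ, 0 < K ∧ ∃ κ : ℝ, 0 < κ ∧ ∃ κ' : ℝ, 0 < κ' ∧ ∃ k : ℕ, ∀ (L : ℕ) [NeZero L] (ψ₀ b : ℝ),
      0 < ψ₀ → ψ₀ ≤ 1 → K * (L : ℝ) ^ k ≤ b →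
        goodIntegral L b - bulkHubIntegral L b ψ₀ ≤
          K * (L : ℝ) ^ k * (ψ₀ ^ κ + b ^ (-κ')) * ((2 * Real.pi / b) ^ alpha L * mbConst L))
    (hS6a : ∃ c : ℝ, 0 < c ∧ ∀ (L : ℕ) [NeZero L] (ψ₀ b : ℝ), 0 ≤ b →
      bulkHubIntegral L b ψ₀ ≤ goodIntegral L b ∧ goodIntegral L b ≤ chartIntegral L b ∧
        chartIntegral L b - goodIntegral L b ≤ Real.exp (-(b * (c / (L : ℝ) ^ 6))))
    (hα : ∀ (L : ℕ) [NeZero L], alpha L = 9 * (L : ℝ) ^ 4 - 1) :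
    ∃ (K₁ K₂ K₃ θ₂ θ₃ : ℝ) (q₁ q₂ q₃ L₀ : ℕ), 0 < K₁ ∧ 0 ≤ K₂ ∧ 0 ≤ K₃ ∧ 0 < θ₂ ∧ θ₂ ≤ 1 ∧ 0 < θ₃ ∧ 1 ≤ q₁ ∧ 1 ≤ L₀ ∧
      (∀ L : ℕ, L₀ ≤ L → ∀ [NeZero L], 0 < mbConst L) ∧
      ∀ (L : ℕ) [NeZero L], L₀ ≤ L → ∀ b : ℝ, K₁ * (L : ℝ) ^ q₁ ≤ b → ∃ Ib R : ℝ,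
        Ib ≤ chartIntegral L b ∧ chartIntegral L b ≤ Ib + R ∧
        |Ib - (2 * Real.pi / b) ^ (9 * (L : ℝ) ^ 4 - 1) * mbConst L| ≤ (K₂ * (L : ℝ) ^ q₂ * b ^ (-θ₂)) * ((2 * Real.pi / b) ^ (9 * (L : ℝ) ^ 4 - 1) * mbConst L) ∧
        R ≤ (K₃ * (L : ℝ) ^ q₃ * b ^ (-θ₃)) * ((2 * Real.pi / b) ^ (9 * (L : ℝ) ^ 4 - 1) * mbConst L) := by
  obtain ⟨K₂, hK₂, k₂, h2⟩ := hS2i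
  obtain ⟨K₄, hK₄, κ, hκ, k₄, h4⟩ := hS4
  obtain ⟨K₅, hK₅, k₅, h4b⟩ := hS4b
  obtain ⟨K₃, hK₃, κ₃, hκ₃, κ', hκ', k₃, h5⟩ := hS5
  obtain ⟨c, hc, h6⟩ := hS6a
  -- the cut exponent
  set σ : ℝ := 1 / (4 * ((k₂ : ℝ) + 1) ^ 2) with hσdef
  obtain ⟨hσ0, hσ1, hσ2, -, -⟩ := sigma_facts k₂
  -- rates and constants
  set θ₂ : ℝ := min (1 / 4) (σ * κ) with hθ₂def
  set θ₃ : ℝ := min (1 / 4) (min (σ * κ₃) κ') with hθ₃def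
  have hθ₂0 : 0 < θ₂ := lt_min (by norm_num) (by positivity)
  have hθ₂1 : θ₂ ≤ 1 := (min_le_left _ _).trans (by norm_num)
  have hθ₃0 : 0 < θ₃ := lt_min (by norm_num) (lt_min (by positivity) hκ')
  -- the threshold polynomial: `P = K* · L^{q*}` dominates every piece; we ask `b ≥ K*²·L^{2q*+1}`
  set Kst : ℝ := K₂ ^ 2 + K₂ ^ k₂ * (40 + K₅) + (40 + K₅) / c + K₃ + 1 with hKst
  set qst : ℕ := 2 * k₂ + (k₂ * k₂ + 4 + k₅) + (10 + k₅) + k₃ with hqst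
  have hn1 : 0 ≤ K₂ ^ 2 := by positivity
  have hn2 : 0 ≤ K₂ ^ k₂ * (40 + K₅) := by positivity
  have hn3 : 0 ≤ (40 + K₅) / c := by positivity
  have hKst1 : 1 ≤ Kst := by rw [hKst]; linarith only [hn1, hn2, hn3, hK₃]
  have hKa : K₂ ^ 2 ≤ Kst := by rw [hKst]; linarith only [hn1, hn2, hn3, hK₃]
  have hKb : K₂ ^ k₂ * (40 + K₅) ≤ Kst := by rw [hKst]; linarith only [hn1, hn2, hn3, hK₃]
  have hKc : (40 + K₅) / c ≤ Kst := by rw [hKst]; linarith only [hn1, hn2, hn3, hK₃]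
  have hKd : K₃ ≤ Kst := by rw [hKst]; linarith only [hn1, hn2, hn3, hK₃]
  have hσk : σ * k₂ ≤ 1 / 4 := by
    have h0 : (0 : ℝ) ≤ σ * k₂ := by positivity
    nlinarith [hσ2, h0]
  refine ⟨Kst ^ 2, K₂ + 1 + K₄, 1 + 2 * K₃, θ₂, θ₃, 2 * qst + 1, max k₂ k₄, k₃, 1, by positivity, by positivity, by positivity,
    hθ₂0, hθ₂1, hθ₃0, by omega, le_rfl, fun L _ _ => (h4 L).1, ?_⟩
  intro L _ hL b hb
  -- window facts
  have hL1 : (1 : ℝ) ≤ L := by exact_mod_cast hL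
  have hL0 : (0 : ℝ) < L := by linarith
  obtain ⟨hb1, hPhalf, hb_half_34, hb_34_1, hb4⟩ := threshold_facts hKst1 hL1 hb
  have hb0 : 0 < b := by linarith
  have hP34 : Kst * (L : ℝ) ^ qst ≤ b ^ (3 / 4 : ℝ) := hPhalf.trans hb_half_34
  have hPb : Kst * (L : ℝ) ^ qst ≤ b := hP34.trans hb_34_1
  -- each piece is dominated by `P`
  have hpiece1 : K₂ ^ 2 * (L : ℝ) ^ (2 * k₂) ≤ Kst * (L : ℝ) ^ qst := monomial_dom hL1 hn1 hKa (by omega)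
  have hpiece2 : K₂ ^ k₂ * (40 + K₅) * (L : ℝ) ^ (k₂ * k₂ + 4 + k₅) ≤ Kst * (L : ℝ) ^ qst := monomial_dom hL1 hn2 hKb (by omega)
  have hpiece3 : (40 + K₅) / c * (L : ℝ) ^ (10 + k₅) ≤ Kst * (L : ℝ) ^ qst := monomial_dom hL1 hn3 hKc (by omega)
  have hpiece4 : K₃ * (L : ℝ) ^ k₃ ≤ Kst * (L : ℝ) ^ qst := monomial_dom hL1 hK₃.le hKd (by omega)
  -- the cut
  set ψ₀ : ℝ := b ^ (-σ) with hψ₀def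
  have hψ0 : 0 < ψ₀ := Real.rpow_pos_of_pos hb0 _
  have hψ1 : ψ₀ ≤ 1 := Real.rpow_le_one_of_one_le_of_nonpos hb1 (by linarith)
  have eψk : (1 / ψ₀) ^ k₂ = b ^ (σ * k₂) := inv_cut_pow hb0 hψ₀def k₂
  have eψκ : ∀ κ₀ : ℝ, ψ₀ ^ κ₀ = b ^ (-(σ * κ₀)) := fun κ₀ => by
    rw [hψ₀def, ← Real.rpow_mul hb0.le]; ring_nf
  -- feed the inputs
  have hT1 : (K₂ * (L : ℝ) ^ k₂ * (1 / ψ₀) ^ k₂) ^ 2 ≤ b := sTwo_threshold_plane hb1 hψ₀def hσ2 (hpiece1.trans hP34)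
  obtain ⟨-, hbulk⟩ := h2 L ψ₀ b hψ0 hψ1 hT1
  obtain ⟨h𝔐pos, h4'⟩ := h4 L
  obtain ⟨hdef0, hdef⟩ := h4' ψ₀ hψ0 hψ1
  have htip := h5 L ψ₀ b hψ0 hψ1 (hpiece4.trans hPb)
  obtain ⟨hIg, hgc, hbad⟩ := h6 L ψ₀ b hb0.le
  rw [hα L] at hbulk htip
  have hA0 : 0 < (2 * Real.pi / b) ^ (9 * (L : ℝ) ^ 4 - 1) := Real.rpow_pos_of_pos (div_pos Real.two_pi_pos hb0) _
  have hMain0 : 0 < (2 * Real.pi / b) ^ (9 * (L : ℝ) ^ 4 - 1) * mbConst L := mul_pos hA0 h𝔐pos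
  -- the exponent data for `exp_absorb`: `e = 9L⁴ − 1 ≤ E = 9L⁴`, `M = K₅ L^{k₅}`
  have hL4 : (1 : ℝ) ≤ (L : ℝ) ^ 4 := one_le_pow₀ hL1
  have he0 : (0 : ℝ) ≤ 9 * (L : ℝ) ^ 4 - 1 := by linarith
  have heE : 9 * (L : ℝ) ^ 4 - 1 ≤ 9 * (L : ℝ) ^ 4 := by linarith
  have hM0 : 0 ≤ K₅ * (L : ℝ) ^ k₅ := by positivity
  -- (A) the off-tube exponential of S2i, (B) the bad-sign exponential of S6a
  have hexpA : Real.exp (-(b * (ψ₀ / (K₂ * (L : ℝ) ^ k₂)) ^ k₂)) ≤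
      b ^ (-(1 / 4 : ℝ)) * ((2 * Real.pi / b) ^ (9 * (L : ℝ) ^ 4 - 1) * mbConst L) :=
    exp_absorb hb1 he0 heE hM0 (h4b L) (offTube_exponent_plane_le hb1 hL1 hK₂ hK₅ hψ₀def hσk (hpiece2.trans hPhalf))
  have hexpB : Real.exp (-(b * (c / (L : ℝ) ^ 6))) ≤ b ^ (-(1 / 4 : ℝ)) * ((2 * Real.pi / b) ^ (9 * (L : ℝ) ^ 4 - 1) * mbConst L) :=
    exp_absorb hb1 he0 heE hM0 (h4b L) (badSign_exponent_le hb1 hL1 hK₅ hc (hpiece3.trans hP34))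
  -- rate comparisons (`b ≥ 1`)
  have hr2 : b ^ (σ * k₂) * b ^ (-(1 / 2 : ℝ)) ≤ b ^ (-θ₂) := by
    rw [← Real.rpow_add hb0]
    exact Real.rpow_le_rpow_of_exponent_le hb1 (by have := min_le_left (1 / 4 : ℝ) (σ * κ); linarith)
  have hr14_2 : b ^ (-(1 / 4 : ℝ)) ≤ b ^ (-θ₂) := Real.rpow_le_rpow_of_exponent_le hb1 (neg_le_neg (min_le_left _ _))
  have hrκ_2 : b ^ (-(σ * κ)) ≤ b ^ (-θ₂) := Real.rpow_le_rpow_of_exponent_le hb1 (neg_le_neg (min_le_right _ _))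
  have hr14_3 : b ^ (-(1 / 4 : ℝ)) ≤ b ^ (-θ₃) := Real.rpow_le_rpow_of_exponent_le hb1 (neg_le_neg (min_le_left _ _))
  have hrκ_3 : b ^ (-(σ * κ₃)) ≤ b ^ (-θ₃) :=
    Real.rpow_le_rpow_of_exponent_le hb1 (neg_le_neg ((min_le_right _ _).trans (min_le_left _ _)))
  have hrκ'_3 : b ^ (-κ') ≤ b ^ (-θ₃) := Real.rpow_le_rpow_of_exponent_le hb1 (neg_le_neg ((min_le_right _ _).trans (min_le_right _ _)))
  have hbθ₂ : 0 ≤ b ^ (-θ₂) := Real.rpow_nonneg hb0.le _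
  have hbθ₃ : 0 ≤ b ^ (-θ₃) := Real.rpow_nonneg hb0.le _
  have hLmax2 : (L : ℝ) ^ k₂ ≤ (L : ℝ) ^ max k₂ k₄ := pow_le_pow_right₀ hL1 (le_max_left _ _)
  have hLmax4 : (L : ℝ) ^ k₄ ≤ (L : ℝ) ^ max k₂ k₄ := pow_le_pow_right₀ hL1 (le_max_right _ _)
  have hLm24 : (1 : ℝ) ≤ (L : ℝ) ^ max k₂ k₄ := one_le_pow₀ hL1
  have hLm3 : (1 : ℝ) ≤ (L : ℝ) ^ k₃ := one_le_pow₀ hL1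
  -- THE DECOMPOSITION `Ib := bulkIntegral`, `R := chart − Ib`
  refine ⟨bulkHubIntegral L b ψ₀, chartIntegral L b - bulkHubIntegral L b ψ₀, hIg.trans hgc, by linarith, ?_, ?_⟩
  · -- two-sided: `|Ib − Main| ≤ (r₁ + b^{−1/4} + D)·Main ≤ (K₂ + 1 + K₄) L^{max} b^{−θ₂}·Main`
    have hmain := bulk_two_sided hA0.le (by linarith) (by positivity) hbulk hexpA hdef
    refine hmain.trans (mul_le_mul_of_nonneg_right ?_ hMain0.le)
    have i1 : K₂ * (L : ℝ) ^ k₂ * (1 / ψ₀) ^ k₂ * b ^ (-(1 / 2 : ℝ)) ≤ K₂ * (L : ℝ) ^ max k₂ k₄ * b ^ (-θ₂) := by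
      rw [eψk, mul_assoc (K₂ * (L : ℝ) ^ k₂)]
      exact mul_le_mul (mul_le_mul_of_nonneg_left hLmax2 hK₂.le) hr2 (by positivity) (by positivity)
    have i2 : b ^ (-(1 / 4 : ℝ)) ≤ (L : ℝ) ^ max k₂ k₄ * b ^ (-θ₂) := hr14_2.trans (le_mul_of_one_le_left hbθ₂ hLm24)
    have i3 : K₄ * (L : ℝ) ^ k₄ * ψ₀ ^ κ ≤ K₄ * (L : ℝ) ^ max k₂ k₄ * b ^ (-θ₂) := by
      rw [eψκ]
      exact mul_le_mul (mul_le_mul_of_nonneg_left hLmax4 (by positivity)) hrκ_2 (Real.rpow_nonneg hb0.le _) (by positivity)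
    have e : (K₂ + 1 + K₄) * (L : ℝ) ^ max k₂ k₄ * b ^ (-θ₂) =
        K₂ * (L : ℝ) ^ max k₂ k₄ * b ^ (-θ₂) + (L : ℝ) ^ max k₂ k₄ * b ^ (-θ₂) + K₄ * (L : ℝ) ^ max k₂ k₄ * b ^ (-θ₂) := by ring
    rw [e]; linarith only [i1, i2, i3]
  · -- rest: `R = (chart − good) + (good − Ib) ≤ (b^{−1/4} + 2K₃L^{k₃}b^{−θ₃})·Main ≤ (1 + 2K₃) L^{k₃} b^{−θ₃}·Main`
    have j1 : ψ₀ ^ κ₃ + b ^ (-κ') ≤ 2 * b ^ (-θ₃) := by rw [eψκ]; linarith only [hrκ_3, hrκ'_3]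
    have j2 : K₃ * (L : ℝ) ^ k₃ * (ψ₀ ^ κ₃ + b ^ (-κ')) * ((2 * Real.pi / b) ^ (9 * (L : ℝ) ^ 4 - 1) * mbConst L) ≤
        2 * K₃ * (L : ℝ) ^ k₃ * b ^ (-θ₃) * ((2 * Real.pi / b) ^ (9 * (L : ℝ) ^ 4 - 1) * mbConst L) := by
      refine mul_le_mul_of_nonneg_right ?_ hMain0.le
      calc K₃ * (L : ℝ) ^ k₃ * (ψ₀ ^ κ₃ + b ^ (-κ')) ≤ K₃ * (L : ℝ) ^ k₃ * (2 * b ^ (-θ₃)) :=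
            mul_le_mul_of_nonneg_left j1 (by positivity)
        _ = 2 * K₃ * (L : ℝ) ^ k₃ * b ^ (-θ₃) := by ring
    have j3 : b ^ (-(1 / 4 : ℝ)) * ((2 * Real.pi / b) ^ (9 * (L : ℝ) ^ 4 - 1) * mbConst L) ≤
        (L : ℝ) ^ k₃ * b ^ (-θ₃) * ((2 * Real.pi / b) ^ (9 * (L : ℝ) ^ 4 - 1) * mbConst L) :=
      mul_le_mul_of_nonneg_right (hr14_3.trans (le_mul_of_one_le_left hbθ₃ hLm3)) hMain0.le
    have e : (1 + 2 * K₃) * (L : ℝ) ^ k₃ * b ^ (-θ₃) * ((2 * Real.pi / b) ^ (9 * (L : ℝ) ^ 4 - 1) * mbConst L) =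
        (L : ℝ) ^ k₃ * b ^ (-θ₃) * ((2 * Real.pi / b) ^ (9 * (L : ℝ) ^ 4 - 1) * mbConst L) +
          2 * K₃ * (L : ℝ) ^ k₃ * b ^ (-θ₃) * ((2 * Real.pi / b) ^ (9 * (L : ℝ) ^ 4 - 1) * mbConst L) := by ring
    rw [e]; linarith only [hbad, hexpB, htip, j2, j3]

end Summit.QuantumFields.YangMills.Theorems.SwapVirialDeficit.SectorLaplace

end
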